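import Literature.Barriers.Parity.SiegelZeroQuadraticPolynomialsTheorem4Core
import Literature.Barriers.Parity.SiegelZeroQuadraticPolynomialsInputs
import Literature.Barriers.Parity.SiegelZeroQuadraticPolynomialsProofs
import HarnessLib

/-!
# Granville–Mollin's Theorem 4 from the two exceptional-prime sparsity inputs

Topic `Literature/Barriers/Parity`, final layer of the proof of
`Literature.Barriers.Parity.GranvilleMollin2000_thm4` (Granville–Mollin, *Rabinowitsch revisited*,
Acta Arith. 96 (2000), Theorem 4: "Suppose that there is a Siegel zero for `L(s, (d/·))` with
`η ≥ log|d|`, where `d ≡ 1 (mod 4)`. Then for `f(x) = x² + x + (1 − d)/4` we have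
`π_f(N) ∼ ϱ_d N`, where `ϱ_d := ∏_{p ≤ √d} (1 − ω(p)/p)`, uniformly in the range
`d^{10} ≤ N ≤ d^{o(η)}`."). Everything is PROVED; no definition is introduced.

* `GranvilleMollin2000_thm4_of` — **Theorem 4** (`GranvilleMollin2000_thm4`, as vendored in
  `SiegelZeroQuadraticPolynomials.lean`) PROVED from the two named inputs of
  `SiegelZeroQuadraticPolynomialsInputs.lean`: `GranvilleMollin2000_eq5_5'` (the display before
  (5.5), §5C: `∑_{p ≤ x} ω(p) log p ≪ x log x/log(d^η)` for `d^C ≤ x < d^η`, a consequence of the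
  explicit formula (3.3) with the Deuring–Heilbronn phenomenon) and
  `GranvilleMollin2000_heathBrownLemma3` (Heath-Brown's Lemma 3 as quoted in §5C). The proof is the
  sieve argument of §6A–6B made explicit in the companion files (`…Progressions`, `…RangesA/B`,
  `…MainEstimate`, `…RelError`, `…Theorem4Prep`, `…Theorem4Core`): given `ε₀`, the sieving
  exponent `ε` (`y = |d|^ε`) is chosen with `Cω e e^{−5/ε} ≤ ε₀/4` (Fundamental Lemma), then
  `δ` (`N ≤ |d|^{δη}`, the `o(η)`) with `4e(1 + Cω) K' δ/log 2 ≤ ε₀/4`, and `d₀` so that the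
  remaining terms (which are `o(1)` as `|d| → ∞` by (5.8) and `η ≥ log|d|`) are `≤ ε₀/2`; for
  `d ≡ 1 (mod 8)` the polynomial has the fixed prime divisor `2`, `ϱ_d = 0 = π_f(N)`.
* `SiegelZeroQuadraticPolynomials_of_inputs` — the catalogued barrier
  `SiegelZeroQuadraticPolynomials` (= Theorem 4 ∧ Proposition 2) from the four named analytic inputs
  `GranvilleMollin2000_eq5_5'`, `GranvilleMollin2000_heathBrownLemma3`, `GranvilleMollin2000_eq33`,
  `TaoTeravainen2021_prop35`.

Trust base of the barrier after this file: these four named facts (all consequences of the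
explicit formula / log-free zero-density theory for real characters, or of Heath-Brown 1983 and
Tao–Teräväinen 2021; none provable in Mathlib at present); everything else is proved in the tree.

[cite: GranvilleMollin2000, Theorem 4, §5C and §6A–6B]
-/

noncomputable section

open Filter Finset Real Polynomial
open scoped Topology
open Literature.NumberTheory.Sieve

namespace Literature.Barriers.Parity

set_option maxHeartbeats 800000 in
/-- **Granville–Mollin's Theorem 4, proved from the two exceptional-prime inputs**
`GranvilleMollin2000_eq5_5'` and `GranvilleMollin2000_heathBrownLemma3`.
[cite: GranvilleMollin2000, Theorem 4, §6A–6B] -/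
theorem GranvilleMollin2000_thm4_of (h55 : GranvilleMollin2000_eq5_5')
    (hHB : GranvilleMollin2000_heathBrownLemma3) : GranvilleMollin2000_thm4 := by
  intro εt hεt
  -- constants from the inputs
  obtain ⟨K, η₅, d₅, H55⟩ := h55 ((19 : ℝ) / 2) (by norm_num)
  obtain ⟨KH, ηH, dH, HHB⟩ := hHB
  set K' : ℝ := max K 1 with hK'
  set K₁ : ℝ := max KH 1 with hK₁
  have hK'1 : 1 ≤ K' := le_max_right _ _
  have hK₁1 : 1 ≤ K₁ := le_max_right _ _
  have hKK' : K ≤ K' := le_max_left _ _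
  have hKK₁ : KH ≤ K₁ := le_max_left _ _
  have hC0 : 0 < SieveSequence.flConst 2 (2 * Real.exp (17 + 12 / Real.log 2)) :=
    SieveSequence.flConst_pos (κ := 2) (K := 2 * Real.exp (17 + 12 / Real.log 2)) (by norm_num) (by positivity)
  have hlog2 : 0 < Real.log 2 := Real.log_pos one_lt_two
  -- the sieving exponent `ε`
  obtain ⟨ε, hε, hε1, hεA⟩ := exists_eps_exp_le
    (A := SieveSequence.flConst 2 (2 * Real.exp (17 + 12 / Real.log 2)) * Real.exp 1) (ε₀ := εt / 4)
    (by positivity) (by positivity)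
  -- the exponent `δ` of the `N`-range
  set δ : ℝ := min (1 / 4) (εt * Real.log 2 /
    (16 * Real.exp 1 * (1 + SieveSequence.flConst 2 (2 * Real.exp (17 + 12 / Real.log 2))) * K')) with hδ
  have hδ0 : 0 < δ := lt_min (by norm_num) (by positivity)
  have hδ1 : δ ≤ 1 / 4 := min_le_left _ _
  have hδA : 4 * Real.exp 1 * (1 + SieveSequence.flConst 2 (2 * Real.exp (17 + 12 / Real.log 2))) * K' * δ /
      Real.log 2 ≤ εt / 4 := by
    set Cω : ℝ := SieveSequence.flConst 2 (2 * Real.exp (17 + 12 / Real.log 2)) with hCω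
    have hC1 : (1 + Cω) ≠ 0 := by linarith
    have hK'ne : K' ≠ 0 := by linarith
    have hlog2ne : Real.log 2 ≠ 0 := hlog2.ne'
    have hene : Real.exp 1 ≠ 0 := (Real.exp_pos 1).ne'
    have h1 : δ ≤ εt * Real.log 2 / (16 * Real.exp 1 * (1 + Cω) * K') := min_le_right _ _
    have hpos : 0 ≤ 4 * Real.exp 1 * (1 + Cω) * K' / Real.log 2 := by
      have : 0 < 1 + Cω := by linarith
      positivity
    calc 4 * Real.exp 1 * (1 + Cω) * K' * δ / Real.log 2
        = 4 * Real.exp 1 * (1 + Cω) * K' / Real.log 2 * δ := by ring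
      _ ≤ 4 * Real.exp 1 * (1 + Cω) * K' / Real.log 2 * (εt * Real.log 2 / (16 * Real.exp 1 * (1 + Cω) * K')) :=
          mul_le_mul_of_nonneg_left h1 hpos
      _ = εt / 4 := by field_simp; ring
  -- the tail threshold
  have hG := tendsto_relErrorTail ε K' K₁ (SieveSequence.flConst 2 (2 * Real.exp (17 + 12 / Real.log 2))) hε hε1
  obtain ⟨qG, hqG⟩ := Filter.eventually_atTop.mp (hG.eventually (Iic_mem_nhds (by positivity : (0 : ℝ) < εt / 2)))
  -- the threshold `d₀`
  set Q₀ : ℝ := max (max (max (max (max qG d₅) dH) 256) (max (Real.exp η₅) (Real.exp ηH)))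
      (max (Real.exp (4 / ε)) (Real.exp (Real.exp (4 * K₁ ^ 2 / ε ^ 2)))) with hQ₀
  refine ⟨δ, hδ0, Q₀, ?_⟩
  intro d hd hdQ q _ hq χ hχp hχq η hη hzero N hN1 hN2
  -- `|d| = q`, `d = -q`
  have hqR : |(d : ℝ)| = (q : ℝ) := by
    have h := congrArg (fun z : ℤ => (z : ℝ)) hq
    push_cast at h
    exact h.symm
  have hdq : d = -(q : ℤ) := by
    have h1 : |d| = -d := abs_of_neg hd.1
    rw [h1] at hq; omega
  have hQq : Q₀ ≤ q := by rw [← hqR]; exact hdQ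
  -- components of the threshold
  have hqG' : qG ≤ q := le_trans (by simp [hQ₀]) hQq
  have hd₅ : d₅ ≤ |(d : ℝ)| := by rw [hqR]; exact le_trans (by simp [hQ₀]) hQq
  have hdH : dH ≤ |(d : ℝ)| := by rw [hqR]; exact le_trans (by simp [hQ₀]) hQq
  have hq256 : (256 : ℝ) ≤ q := le_trans (by simp [hQ₀]) hQq
  have hqη₅ : Real.exp η₅ ≤ q := le_trans (by simp [hQ₀]) hQq
  have hqηH : Real.exp ηH ≤ q := le_trans (by simp [hQ₀]) hQq
  have hqε : Real.exp (4 / ε) ≤ q := le_trans (by simp [hQ₀]) hQq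
  have hqK : Real.exp (Real.exp (4 * K₁ ^ 2 / ε ^ 2)) ≤ q := le_trans (by simp [hQ₀]) hQq
  have hq0 : (0 : ℝ) < q := by linarith
  have hLη : Real.log q ≤ η := by rw [← hqR]; exact hη
  have hη₅ : η₅ ≤ η := le_trans ((Real.le_log_iff_exp_le hq0).mpr hqη₅) hLη
  have hηH : ηH ≤ η := le_trans ((Real.le_log_iff_exp_le hq0).mpr hqηH) hLη
  have hεL : 4 ≤ ε * Real.log q := by
    have h := (Real.le_log_iff_exp_le hq0).mpr hqε
    rw [div_le_iff₀ hε] at h; linarith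
  have hLL : 4 * K₁ ^ 2 / ε ^ 2 ≤ Real.log (Real.log q) := by
    have h := (Real.le_log_iff_exp_le hq0).mpr hqK
    have hpos : 0 < Real.exp (4 * K₁ ^ 2 / ε ^ 2) := Real.exp_pos _
    exact (Real.le_log_iff_exp_le (lt_of_lt_of_le hpos h)).mpr h
  have hN1' : (q : ℝ) ^ (10 : ℝ) ≤ N := by rw [← hqR]; exact hN1
  have hN2' : (N : ℝ) ≤ (q : ℝ) ^ (δ * η) := by rw [← hqR]; exact hN2
  -- `q ≡ 3 (mod 4)`; the two classes mod 8
  have hq4 : q % 4 = 3 := by have := hd.2.2; rw [hdq] at this; omega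
  rcases (show q % 8 = 3 ∨ q % 8 = 7 by omega) with hq8 | hq8
  · -- the main case `d ≡ 5 (mod 8)`
    have hη0 : 0 < η := by
      have : 0 < Real.log q := Real.log_pos (by linarith); linarith
    have h55i : ∀ t : ℝ, (q : ℝ) ^ ((19 : ℝ) / 2) ≤ t → t < (q : ℝ) ^ η →
        ∑ p ∈ Nat.primesLE ⌊t⌋₊, (polyRootCountMod ![rabinowitschPoly d] p : ℝ) * Real.log p ≤
          K' / (η * Real.log q) * (t * Real.log t) := by
      intro t ht1 ht2
      have h := H55 d hd hd₅ q hq χ hχp hχq η hη₅ hzero t (by rw [hqR]; exact ht1) (by rw [hqR]; exact ht2)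
      rw [hqR] at h
      have ht1' : 1 ≤ t := by
        have : (1 : ℝ) ≤ (q : ℝ) ^ ((19 : ℝ) / 2) := Real.one_le_rpow (by linarith) (by norm_num)
        linarith
      have hnn : 0 ≤ t * Real.log t / (η * Real.log q) := by
        have := Real.log_nonneg ht1'
        have := Real.log_pos (show (1 : ℝ) < q by linarith)
        positivity
      calc ∑ p ∈ Nat.primesLE ⌊t⌋₊, (polyRootCountMod ![rabinowitschPoly d] p : ℝ) * Real.log p
          ≤ K * (t * Real.log t / (η * Real.log q)) := h
        _ ≤ K' * (t * Real.log t / (η * Real.log q)) := mul_le_mul_of_nonneg_right hKK' hnn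
        _ = K' / (η * Real.log q) * (t * Real.log t) := by ring
    have hHi : ∑ p ∈ Nat.primesLE ⌊(q : ℝ) ^ (500 : ℝ)⌋₊,
        (polyRootCountMod ![rabinowitschPoly d] p : ℝ) * Real.log p / p ≤
          K₁ * (Real.log q / Real.sqrt (Real.log η)) := by
      have h := HHB d hd hdH q hq χ hχp hχq η hηH hzero
      rw [hqR] at h
      have hnn : 0 ≤ Real.log q / Real.sqrt (Real.log η) := by
        have := Real.log_pos (show (1 : ℝ) < q by linarith); positivity
      exact h.trans (mul_le_mul_of_nonneg_right hKK₁ hnn)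
    have hcore := thm4_core hdq hq8 hε hε1 hδ0 hδ1 hK'1 hK₁1 hq256 hεL hLL hLη hN1' hN2' h55i hHi
    have hGq := hqG q hqG'
    change _ ≤ εt / 2 at hGq
    have hρN : 0 ≤ gmRho d * N := mul_nonneg (gmRho_pos hdq hq8).le (Nat.cast_nonneg N)
    refine hcore.trans ?_
    rw [mul_comm εt]
    exact mul_le_mul_of_nonneg_left (by linarith) hρN
  · -- the trivial case `d ≡ 1 (mod 8)`: `π_f(N) = 0 = ϱ_d`
    have hq15 : 15 ≤ q := by
      have : (15 : ℝ) ≤ q := by linarith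
      exact_mod_cast this
    rw [polyPrimeCount_rabinowitsch_eq_zero hdq hq8 hq15 N, gmRho_eq_zero hdq hq8 (by omega)]
    simp

/-- **The catalogued barrier from the four named analytic inputs**:
`SiegelZeroQuadraticPolynomials` (= Theorem 4 ∧ Proposition 2 of Granville–Mollin 2000) follows from
`GranvilleMollin2000_eq5_5'`, `GranvilleMollin2000_heathBrownLemma3` (Theorem 4) and
`GranvilleMollin2000_eq33`, `TaoTeravainen2021_prop35` (Proposition 2).
[cite: GranvilleMollin2000, Theorem 4 and Proposition 2] -/
theorem SiegelZeroQuadraticPolynomials_of_inputs (h55 : GranvilleMollin2000_eq5_5')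
    (hHB : GranvilleMollin2000_heathBrownLemma3)
    (h33 : Literature.NumberTheory.LFunctions.SiegelZero.GranvilleMollin2000_eq33)
    (h35 : Literature.NumberTheory.LFunctions.SiegelZero.TaoTeravainen2021_prop35) :
    SiegelZeroQuadraticPolynomials :=
  SiegelZeroQuadraticPolynomials_of_thm4_of_eq33_of_prop35 (GranvilleMollin2000_thm4_of h55 hHB) h33 h35

end Literature.Barriers.Parity
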